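import Literature.Analysis.ValidatedNumerics.ExpPoly.Poly
import HarnessLib

/-!
# Exact exp-polynomial algebra over `ℚ`, IV: bivariate coefficient lists and the correlation polynomial

Continues `ExpPoly/Poly.lean` (same directory, same conventions: computable list data over `ℚ`, real
denotations by Horner evaluation, one soundness identity per operation, closed terms reduce in the
kernel).  The object of this file is the exact CORRELATION of two polynomials over a symmetric window:
for coefficient lists `u, v : Poly` and a rational half-width `b`,

  `D(t) = ∫_{-b}^{b-t} u(x + t) · v(x) dx`

is a polynomial in `t`, and `Poly.corr u v b : Poly` computes its coefficients exactly
(`Poly.eval_corr`).  This is what turns quadratic forms `∬ u(x) v(y) k(x − y) dx dy` with an even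
kernel `k` into one-dimensional moment sums `Σₙ dₙ ∫ tⁿ k(t) dt` (`Poly.integral_eval_mul_eq_sum`),
so that a kernel-checked table of moments of `k` certifies such forms (use: the archimedean term of
Weil's explicit formula against polynomial Ritz vectors, where `k` is the density
`e^{-t/2}/(1 − e^{-2t})` and only the increments `D(0) − D(t) = t · E(t)` (`Poly.incTail`,
`Poly.eval_zero_sub_eval`) are integrated).

The computation goes through BIVARIATE coefficient lists `BPoly = List Poly` (entry `n` = the
coefficient of `xⁿ`, itself a polynomial in the parameter `t`): `BPoly.eval`, `add`, `cmul`, `mul`,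
the substitution `u ↦ u(x + t)` (`BPoly.taylor`), constants-in-`t` (`BPoly.const`), the antiderivative
in `x` (`BPoly.integ`, soundness `BPoly.hasDerivAt_eval_integ` in power form exactly as
`Poly.hasDerivAt_divFrom`), and the substitution `x := ℓ(t)` back to one variable (`BPoly.subst`).

NOT here: estimates of any kind (everything is an identity), non-rational endpoints, kernels.

## Main definitions (namespace `Literature.Analysis.ValidatedNumerics.ExpPoly`)

* `BPoly := List Poly`, `BPoly.eval P t x : ℝ`, `BPoly.add`, `BPoly.cmul`, `BPoly.mul`, `BPoly.xAddT`,
  `BPoly.taylor`, `BPoly.const`, `BPoly.evalFrom`, `BPoly.divFrom`, `BPoly.integ`, `BPoly.subst`.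
* `Poly.corr u v b : Poly` — coefficients of `t ↦ ∫_{-b}^{b-t} u(x+t) v(x) dx`.
* `Poly.incTail d : Poly` — coefficients of `E` in `d(0) − d(t) = t · E(t)`.

## Main results

* `BPoly.eval_add/eval_cmul/eval_mul/eval_taylor/eval_const/eval_subst`, `BPoly.continuous_eval`,
  `BPoly.hasDerivAt_eval_integ`, `BPoly.integral_eval`.
* `Poly.eval_corr : eval (corr u v b) t = ∫ x in (-b)..(b - t), eval u (x + t) * eval v x`.
* `Poly.eval_zero_sub_eval : eval d 0 - eval d t = t * eval (incTail d) t`.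
* `Poly.eval_eq_sum_getD : eval p x = Σ_{n < p.length} p[n] xⁿ`,
  `Poly.integral_eval_mul_eq_sum : ∫ eval p · w = Σₙ p[n] ∫ tⁿ w(t) dt`.

## References

* Fundamental theorem of calculus for continuous integrands (W. Rudin, *Principles of Mathematical
  Analysis*, 3rd ed., Thm 6.21); Horner's rule; the substitution `u(x+t) = Σ uᵢ (x+t)ⁱ`. [folklore]
-/

open Real MeasureTheory intervalIntegral

namespace Literature.Analysis.ValidatedNumerics.ExpPoly

/-! ## Bivariate coefficient lists -/

/-- Bivariate polynomial data: entry `n` is the coefficient of `xⁿ`, a polynomial (coefficient list)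
in the parameter `t`. [folklore] -/
abbrev BPoly := List Poly

namespace BPoly

/-- Real denotation: Horner in `x` with the coefficients `Poly.eval c t`. [folklore] -/
def eval : BPoly → ℝ → ℝ → ℝ
  | [], _, _ => 0
  | c :: P, t, x => Poly.eval c t + x * eval P t x

/-- [folklore] -/
@[simp] theorem eval_nil (t x : ℝ) : eval [] t x = 0 := rfl
/-- [folklore] -/
@[simp] theorem eval_cons (c : Poly) (P : BPoly) (t x : ℝ) :
    eval (c :: P) t x = Poly.eval c t + x * eval P t x := rfl

/-- Coefficientwise sum. [folklore] -/
def add : BPoly → BPoly → BPoly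
  | [], Q => Q
  | P, [] => P
  | c :: P, d :: Q => Poly.add c d :: add P Q

/-- [folklore] -/
@[simp] theorem add_nil_left (Q : BPoly) : add [] Q = Q := by cases Q <;> rfl
/-- [folklore] -/
@[simp] theorem add_nil_right (P : BPoly) : add P [] = P := by cases P <;> rfl
/-- [folklore] -/
@[simp] theorem add_cons_cons (c d : Poly) (P Q : BPoly) :
    add (c :: P) (d :: Q) = Poly.add c d :: add P Q := rfl

/-- Soundness of `add`. [folklore] -/
theorem eval_add : ∀ (P Q : BPoly) (t x : ℝ), eval (add P Q) t x = eval P t x + eval Q t x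
  | [], Q, t, x => by simp
  | c :: P, [], t, x => by simp
  | c :: P, d :: Q, t, x => by
      simp only [add_cons_cons, eval_cons, Poly.eval_add, eval_add P Q t x]; ring

/-- Multiply every coefficient by a fixed polynomial in `t`. [folklore] -/
def cmul (c : Poly) (P : BPoly) : BPoly := P.map (Poly.mul c)

/-- [folklore] -/
@[simp] theorem cmul_nil (c : Poly) : cmul c [] = [] := rfl
/-- [folklore] -/
@[simp] theorem cmul_cons (c d : Poly) (P : BPoly) : cmul c (d :: P) = Poly.mul c d :: cmul c P := rfl

/-- Soundness of `cmul`. [folklore] -/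
theorem eval_cmul (c : Poly) : ∀ (P : BPoly) (t x : ℝ), eval (cmul c P) t x = Poly.eval c t * eval P t x
  | [], t, x => by simp
  | d :: P, t, x => by simp only [cmul_cons, eval_cons, Poly.eval_mul, eval_cmul c P t x]; ring

/-- Product in `x` (`(c + x P) Q = c Q + x (P Q)`). [folklore] -/
def mul : BPoly → BPoly → BPoly
  | [], _ => []
  | c :: P, Q => add (cmul c Q) ([] :: mul P Q)

/-- Soundness of `mul`. [folklore] -/
theorem eval_mul : ∀ (P Q : BPoly) (t x : ℝ), eval (mul P Q) t x = eval P t x * eval Q t x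
  | [], Q, t, x => by simp [mul]
  | c :: P, Q, t, x => by
      simp only [mul, eval_add, eval_cmul, eval_cons, Poly.eval_nil, eval_mul P Q t x]; ring

/-- The bivariate polynomial `x + t`. [folklore] -/
def xAddT : BPoly := [[0, 1], [1]]

/-- [folklore] -/
theorem eval_xAddT (t x : ℝ) : eval xAddT t x = x + t := by
  simp [xAddT, eval, Poly.eval]; ring

/-- `u(x + t)` as a bivariate list (Horner in `x + t`). [folklore] -/
def taylor (u : Poly) : BPoly := u.foldr (fun a acc => add [[a]] (mul xAddT acc)) []

/-- Soundness of `taylor`: `eval (taylor u) t x = u(x + t)`. [folklore] -/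
theorem eval_taylor (t x : ℝ) : ∀ (u : Poly), eval (taylor u) t x = Poly.eval u (x + t)
  | [] => by simp [taylor]
  | a :: u => by
      have ih := eval_taylor t x u
      simp only [taylor, List.foldr_cons] at ih ⊢
      rw [eval_add, eval_mul, eval_xAddT, ih]
      simp [eval, Poly.eval]

/-- `v(x)` with coefficients constant in `t`. [folklore] -/
def const (v : Poly) : BPoly := v.map fun a => [a]

/-- Soundness of `const`. [folklore] -/
theorem eval_const (t x : ℝ) : ∀ (v : Poly), eval (const v) t x = Poly.eval v x
  | [] => by simp [const]
  | a :: v => by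
      have ih := eval_const t x v
      simp only [const, List.map_cons, eval_cons, Poly.eval_cons] at ih ⊢
      rw [ih]; simp [Poly.eval]

/-- `x ↦ eval P t x` is continuous. [folklore] -/
theorem continuous_eval (t : ℝ) : ∀ (P : BPoly), Continuous fun x => eval P t x
  | [] => by simpa using continuous_const
  | c :: P => by
      show Continuous fun x => Poly.eval c t + x * eval P t x
      exact continuous_const.add (continuous_id.mul (continuous_eval t P))

/-! ### Antiderivative in `x` (power form, as `Poly.divFrom`) -/

/-- Power-form evaluation `evalFrom m [c₀, c₁, …] t x = Σᵢ cᵢ(t) x^{m+i}`. [folklore] -/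
def evalFrom : ℕ → BPoly → ℝ → ℝ → ℝ
  | _, [], _, _ => 0
  | m, c :: P, t, x => Poly.eval c t * x ^ m + evalFrom (m + 1) P t x

/-- [folklore] -/
@[simp] theorem evalFrom_nil (m : ℕ) (t x : ℝ) : evalFrom m [] t x = 0 := rfl
/-- [folklore] -/
@[simp] theorem evalFrom_cons (m : ℕ) (c : Poly) (P : BPoly) (t x : ℝ) :
    evalFrom m (c :: P) t x = Poly.eval c t * x ^ m + evalFrom (m + 1) P t x := rfl

/-- Power form versus Horner form. [folklore] -/
theorem evalFrom_eq : ∀ (m : ℕ) (P : BPoly) (t x : ℝ), evalFrom m P t x = x ^ m * eval P t x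
  | m, [], t, x => by simp
  | m, c :: P, t, x => by
      simp only [evalFrom_cons, eval_cons, evalFrom_eq (m + 1) P t x, pow_succ]; ring

/-- `divFrom m [c₀, c₁, …] = [c₀/m, c₁/(m+1), …]`. [folklore] -/
def divFrom : ℕ → BPoly → BPoly
  | _, [] => []
  | m, c :: P => Poly.smul (1 / m) c :: divFrom (m + 1) P

/-- Soundness of `divFrom`: `y ↦ Σᵢ cᵢ(t)/(m+1+i) · y^{m+1+i}` has `x`-derivative `Σᵢ cᵢ(t) x^{m+i}`.
[folklore] -/
theorem hasDerivAt_evalFrom_divFrom (t : ℝ) :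
    ∀ (m : ℕ) (P : BPoly) (x : ℝ),
      HasDerivAt (fun y => evalFrom (m + 1) (divFrom (m + 1) P) t y) (evalFrom m P t x) x
  | m, [], x => by
      simpa [divFrom] using hasDerivAt_const x (0 : ℝ)
  | m, c :: P, x => by
      have ih := hasDerivAt_evalFrom_divFrom t (m + 1) P x
      have hpow : HasDerivAt (fun y : ℝ => y ^ (m + 1)) (((m + 1 : ℕ) : ℝ) * x ^ (m + 1 - 1)) x :=
        hasDerivAt_pow (m + 1) x
      have h1 := hpow.const_mul (Poly.eval (Poly.smul (1 / ((m + 1 : ℕ) : ℚ)) c) t)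
      have h2 := h1.add ih
      show HasDerivAt (fun y => Poly.eval (Poly.smul (1 / ((m + 1 : ℕ) : ℚ)) c) t * y ^ (m + 1) +
          evalFrom (m + 1 + 1) (divFrom (m + 1 + 1) P) t y) (evalFrom m (c :: P) t x) x
      refine h2.congr_deriv ?_
      rw [evalFrom_cons, Nat.add_sub_cancel, Poly.eval_smul]
      have hm : (((m + 1 : ℕ) : ℚ) : ℝ) ≠ 0 := by positivity
      push_cast at hm ⊢
      field_simp

/-- Antiderivative in `x` with zero constant term. [folklore] -/
def integ (P : BPoly) : BPoly := [] :: divFrom 1 P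

/-- Soundness of `integ`: `∂ₓ eval (integ P) t x = eval P t x`. [folklore] -/
theorem hasDerivAt_eval_integ (P : BPoly) (t x : ℝ) :
    HasDerivAt (fun y => eval (integ P) t y) (eval P t x) x := by
  have h := hasDerivAt_evalFrom_divFrom t 0 P x
  have hfun : (fun y => eval (integ P) t y) = fun y => evalFrom 1 (divFrom 1 P) t y := by
    funext y
    simp [integ, evalFrom_eq]
  rw [hfun]
  simpa [evalFrom_eq] using h

/-- The definite `x`-integral of a bivariate list: `∫_α^β P(t, x) dx = (integ P)(t, β) − (integ P)(t, α)`.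
[folklore] -/
theorem integral_eval (P : BPoly) (t α β : ℝ) :
    ∫ x in α..β, eval P t x = eval (integ P) t β - eval (integ P) t α :=
  integral_eq_sub_of_hasDerivAt (fun x _ => hasDerivAt_eval_integ P t x)
    ((continuous_eval t P).intervalIntegrable _ _)

/-- Substitute `x := ℓ(t)`: the univariate list of `t ↦ P(t, ℓ(t))`. [folklore] -/
def subst (P : BPoly) (ℓ : Poly) : Poly := P.foldr (fun c acc => Poly.add c (Poly.mul ℓ acc)) []

/-- Soundness of `subst`. [folklore] -/
theorem eval_subst (ℓ : Poly) (t : ℝ) : ∀ (P : BPoly), Poly.eval (subst P ℓ) t = eval P t (Poly.eval ℓ t)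
  | [] => by simp [subst]
  | c :: P => by
      have ih := eval_subst ℓ t P
      simp only [subst, List.foldr_cons] at ih ⊢
      rw [Poly.eval_add, Poly.eval_mul, ih, eval_cons]

end BPoly

/-! ## The correlation polynomial -/

namespace Poly

/-- Coefficients (in `t`) of the window correlation `D(t) = ∫_{-b}^{b-t} u(x + t) v(x) dx`:
antiderivative in `x` of `u(x+t) v(x)`, evaluated between `x = -b` and `x = b − t`. [folklore] -/
def corr (u v : Poly) (b : ℚ) : Poly :=
  let W := BPoly.integ (BPoly.mul (BPoly.taylor u) (BPoly.const v))
  add (BPoly.subst W [b, -1]) (smul (-1) (BPoly.subst W [-b]))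

/-- **Exact correlation.** For all coefficient lists `u, v`, every rational `b` and every real `t`,
`eval (corr u v b) t = ∫_{-b}^{b-t} u(x + t) v(x) dx`. [folklore] -/
theorem eval_corr (u v : Poly) (b : ℚ) (t : ℝ) :
    eval (corr u v b) t = ∫ x in (-(b : ℝ))..((b : ℝ) - t), eval u (x + t) * eval v x := by
  set Q : BPoly := BPoly.mul (BPoly.taylor u) (BPoly.const v) with hQ
  have hint : ∫ x in (-(b : ℝ))..((b : ℝ) - t), eval u (x + t) * eval v x =
      ∫ x in (-(b : ℝ))..((b : ℝ) - t), BPoly.eval Q t x := by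
    refine integral_congr fun x _ => ?_
    simp only [hQ, BPoly.eval_mul, BPoly.eval_taylor, BPoly.eval_const]
  have hl1 : eval [b, -1] t = (b : ℝ) - t := by simp [eval]; ring
  have hl2 : eval [-b] t = -(b : ℝ) := by simp [eval]
  rw [hint, BPoly.integral_eval, corr]
  simp only [eval_add, eval_smul, BPoly.eval_subst, hl1, hl2, ← hQ]
  push_cast
  ring

/-- The increment tail: coefficients of `E` in `d(0) − d(t) = t · E(t)` (drop the constant term and
negate). [folklore] -/
def incTail (d : Poly) : Poly := (smul (-1) d).tail

/-- `d(0) − d(t) = t · (incTail d)(t)`. [folklore] -/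
theorem eval_zero_sub_eval : ∀ (d : Poly) (t : ℝ), eval d 0 - eval d t = t * eval (incTail d) t
  | [], t => by simp [incTail]
  | a :: d, t => by
      simp only [incTail, smul_cons, List.tail_cons, eval_cons, eval_smul, zero_mul, add_zero]
      push_cast; ring

/-! ## From polynomials to moment sums -/

/-- Horner form as a sum of monomials: `eval p x = Σ_{n < |p|} p[n] xⁿ`. [folklore] -/
theorem eval_eq_sum_getD : ∀ (p : Poly) (x : ℝ),
    eval p x = ∑ n ∈ Finset.range p.length, ((p.getD n 0 : ℚ) : ℝ) * x ^ n
  | [], x => by simp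
  | a :: p, x => by
      rw [eval_cons, eval_eq_sum_getD p x, List.length_cons, Finset.sum_range_succ', Finset.mul_sum]
      simp only [List.getD_cons_succ, List.getD_cons_zero, pow_zero, mul_one, pow_succ]
      rw [add_comm]
      congr 1
      exact Finset.sum_congr rfl fun n _ => by ring

/-- **Moment sum.** `∫_α^β p(t) w(t) dt = Σₙ p[n] ∫_α^β tⁿ w(t) dt` whenever every `tⁿ w` is interval
integrable. [folklore] -/
theorem integral_eval_mul_eq_sum (p : Poly) {w : ℝ → ℝ} {α β : ℝ}
    (hw : ∀ n : ℕ, IntervalIntegrable (fun t : ℝ => t ^ n * w t) volume α β) :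
    ∫ t in α..β, eval p t * w t =
      ∑ n ∈ Finset.range p.length, ((p.getD n 0 : ℚ) : ℝ) * ∫ t in α..β, t ^ n * w t := by
  have h1 : ∫ t in α..β, eval p t * w t =
      ∫ t in α..β, ∑ n ∈ Finset.range p.length, ((p.getD n 0 : ℚ) : ℝ) * (t ^ n * w t) := by
    refine integral_congr fun t _ => ?_
    simp only [eval_eq_sum_getD, Finset.sum_mul, mul_assoc]
  rw [h1, integral_finsetSum fun n _ => (hw n).const_mul _]
  exact Finset.sum_congr rfl fun n _ => intervalIntegral.integral_const_mul _ _

end Poly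

end Literature.Analysis.ValidatedNumerics.ExpPoly
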